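import Summits.Langlands.Langlands.Theses.FiniteLevelTorsionSplit
import Literature.NumberTheory.GaloisRepresentations.GaloisRepFrobeniusProofs
import Literature.NumberTheory.GaloisRepresentations.ResidualGaloisRep

/-! # Level-one dyadic automorphy — the CONGRUENCE-TRANSIT engine (lens-4 g19, node `GenuineTorsionSplit`)

Sorry-free algebra behind the g19 node on TZ = `FiniteLevelTorsionSplit.DefectZeroTorsionAutomorphy`
(stmt-Langlands-26851, crux r3 of route-Langlands-FiniteLevelTorsionSplit rev 0).  Everything here is
valid for EVERY prime `p`, rank `n` and number field `K` (no defect, no box), and uses only proved tree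
lemmas: `IsReductionOf.hasResidualCharpolys` (Darmon–Diamond–Taylor §2.1),
`GaloisRep.hasFrobCharpolyAt_frobCharpoly_holds` (Serre I.2.1: an unramified representation HAS a
Frobenius characteristic polynomial), `Polynomial.map_injective` along `ℤ̄_p ↪ ℚ̄_p`, and the
coefficientwise functoriality of the Hecke–Frobenius polynomial `heckeFrobPoly`.

* `exists_integral_frobCharpoly` — if `τ̄` is a reduction of `ρ : Γ_K → GL_n(ℚ̄_p)` and `ρ` is
  unramified at `v`, then for any Frobenius `φ` at a prime above `v` there is `P ∈ ℤ̄_p[X]` with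
  `ρ.HasFrobCharpolyAt v P` and `P mod 𝔪 = det(X − τ̄(φ))`.
* `residuallyAutomorphic_of_assoc` (THE JUNCTION) — if a reduction `τ̄` of `ρ` is ASSOCIATED
  (`IsAssociatedFamily`) with the reduction of a `ℤ̄_p`-valued family `a` outside a finite set `S`, and a
  cuspidal L-algebraic `π` has Satake polynomials `= heckeFrobPoly n q_v (a v)` at almost all `v`, then
  `ρ` is RESIDUALLY AUTOMORPHIC via `π` in the exact `TAIL` format of the lens-4 lineage
  (`∃ P Q ∈ ℤ̄_p[X], ρ.HasFrobCharpolyAt v P ∧ Satake_v(π) = Q ∧ P ≡ Q mod 𝔪` a.e.).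
* `residuallyAutomorphic_transit` — residual automorphy passes along a congruence: `ρ ≡ σ mod 𝔪`
  (a common reduction `τ̄`) and `σ` residually automorphic ⇒ `ρ` residually automorphic.
* `defectZeroLifting` — the REGISTERED g18 line stub `stub_defectZeroLifting` of
  `Cruxes/DefectZeroTorsionAutomorphy/Lines/classical-avatar.lean` (labelled there "2-adic automorphy
  lifting"), with its signature VERBATIM, is a COROLLARY of the transit: it is transitivity of congruence,
  not a lifting theorem.  Together with `classicalAvatar_of_defectZero` (the other g18 stub follows from
  TZ itself with `σ := ρ`) this shows the g18 line CAV ∧ ALT was a costume split of TZ; the g19 node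
  `GenuineTorsionSplit` replaces it by the honest cut (characteristic-zero avatar vs genuine torsion).

No `sorry`, no new axioms. -/

set_option linter.unusedVariables false
set_option linter.dupNamespace false
set_option linter.unusedSectionVars false

namespace Summit.Langlands.Langlands.Theorems.LevelOneDyadic.Transit

open scoped NumberField
open Filter IsDedekindDomain Polynomial
open Literature.NumberTheory.GaloisRepresentations Literature.NumberTheory.Automorphic
open Literature.NumberTheory.Automorphic.BigHeckeGLn

universe u

variable {K : Type} [Field K] [NumberField K] {n : ℕ} {p : ℕ} [Fact p.Prime]

/-! ### Coefficientwise functoriality of the Hecke–Frobenius polynomial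
The identity `(heckeFrobPoly m q a).map g = heckeFrobPoly m q (g ∘ a)` is already landed as
`Summit.Langlands.Langlands.Cruxes.ReducibleOrdinaryProModular.SteinbergHyperplane.heckeFrobPoly_map`
(module `Theorems/SkinnerWilesDefectOneProModularOfEisensteinSeedProModularPrimes`, inside the cone of route
`SkinnerWilesDefectOne`); to keep this engine outside that route's import cone it is re-derived INLINE (a `have`
by `simp [heckeFrobPoly, Polynomial.map_sum]`) at its single use in `residuallyAutomorphic_of_assoc` below. -/

/-! ### Integral Frobenius polynomials of a representation with a given reduction -/

/-- If `τ̄` is a reduction of `ρ : Γ_K → GL_n(ℚ̄_p)` (`IsReductionOf` along `ℤ̄_p/𝔪 = 𝔽̄_p`) and `ρ` is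
unramified at `v`, then for every arithmetic Frobenius `φ` at a prime `𝔓 ∣ v` there is an INTEGRAL
polynomial `P ∈ ℤ̄_p[X]` which is the Frobenius characteristic polynomial of `ρ` at `v` and whose
reduction is `det(X − τ̄(φ))`.  (Serre I.2.1 + Darmon–Diamond–Taylor §2.1.) [folklore] -/
theorem exists_integral_frobCharpoly {k : Type*} [Field k]
    (ρ : FramedGaloisRep K (PadicAlgCl p) n) {ι' : padicAlgClResidueField p →+* k}
    {τ : Field.absoluteGaloisGroup K →* GL (Fin n) k}
    (hρτ : ρ.IsReductionOf ι' τ) {v : HeightOneSpectrum (𝓞 K)} (hv : ρ.IsUnramifiedAt v)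
    {𝔓 : Ideal _} (h𝔓 : 𝔓 ∈ v.primesAbove) {φ : Field.absoluteGaloisGroup K}
    (hφ : IsArithFrobAt (𝓞 K) φ 𝔓) :
    ∃ P : Polynomial (padicAlgClIntegers p),
      ρ.HasFrobCharpolyAt v (P.map (padicAlgClIntegers p).subtype) ∧
      P.map (ι'.comp (IsLocalRing.residue (padicAlgClIntegers p))) =
        ((τ φ : GL (Fin n) k) : Matrix (Fin n) (Fin n) k).charpoly := by
  obtain ⟨P, hP1, hP2⟩ :=
    Literature.NumberTheory.GaloisRepresentations.IsReductionOf.hasResidualCharpolys hρτ φ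
  refine ⟨P, ?_, hP2⟩
  have hunr : ρ.toGaloisRep.IsUnramifiedAt v :=
    (FramedGaloisRep.isUnramifiedAt_toGaloisRep_iff v ρ).mpr hv
  have hF : ρ.HasFrobCharpolyAt v (ρ.toGaloisRep.frobCharpoly v) :=
    (FramedGaloisRep.hasFrobCharpolyAt_toGaloisRep_iff v _ ρ).mp
      (GaloisRep.hasFrobCharpolyAt_frobCharpoly_holds hunr)
  have hch : FramedRep.charpoly ρ φ = ρ.toGaloisRep.frobCharpoly v := hF 𝔓 h𝔓 φ hφ
  intro 𝔓' h𝔓' σ hσ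
  rw [hF 𝔓' h𝔓' σ hσ, ← hch, hP1]
  rfl

/-! ### The `TAIL` format of the lineage and the junction -/

/-- `IsResiduallyAutomorphicVia hcpt ι ρ π`: the cuspidal `π` is L-algebraic and, at almost every place,
`ρ` is unramified, `π` has a Satake parameter, and the Frobenius polynomial of `ρ` and the Satake
polynomial of `π` are INTEGRAL and CONGRUENT mod `𝔪(ℤ̄_p)` — the `TAIL` of every statement of the
lens-4 lineage since g14 (`LevelOneDyadic.Residue.IsResiduallyAutomorphic` is `∃ π`, this). -/
def IsResiduallyAutomorphicVia (hcpt : isCompact_glFiniteIntegralLevel n K) (ι : PadicAlgCl p ≃+* ℂ)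
    (ρ : FramedGaloisRep K (PadicAlgCl p) n) (π : CuspidalAutomorphicRepData n K hcpt) : Prop :=
  π.1.IsLAlgebraic ∧ ∀ᶠ v : HeightOneSpectrum (𝓞 K) in cofinite,
    ρ.IsUnramifiedAt v ∧ (∃ α : Multiset ℂ, π.1.HasSatakeParamAt v α) ∧
      ∀ α : Multiset ℂ, π.1.HasSatakeParamAt v α →
        ∃ P Q : Polynomial (padicAlgClIntegers p),
          ρ.HasFrobCharpolyAt v (P.map (padicAlgClIntegers p).subtype) ∧
          arithFrobPolyOfSatake ι v.residueCard 1 α = Q.map (padicAlgClIntegers p).subtype ∧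
          P.map (IsLocalRing.residue (padicAlgClIntegers p)) =
            Q.map (IsLocalRing.residue (padicAlgClIntegers p))

/-- **THE JUNCTION.**  A reduction `τ̄` of `ρ` associated (outside a finite `S`) with the reduction of a
`ℤ̄_p`-valued family `a`, and a cuspidal L-algebraic `π` whose Satake polynomials are the Hecke–Frobenius
polynomials of `a` almost everywhere, make `ρ` residually automorphic via `π`.  Pure algebra:
`P :=` the integral Frobenius polynomial of `ρ` (`exists_integral_frobCharpoly`), `Q := heckeFrobPoly (a v)`,
and `P ≡ Q mod 𝔪` because both reduce to `det(X − τ̄(Frob_v))`. [folklore] -/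
theorem residuallyAutomorphic_of_assoc [TopologicalSpace (padicAlgClResidueField p)]
    (hcpt : isCompact_glFiniteIntegralLevel n K) (ι : PadicAlgCl p ≃+* ℂ)
    (ρ : FramedGaloisRep K (PadicAlgCl p) n)
    (τ : FramedGaloisRep K (padicAlgClResidueField p) n)
    (hρτ : ρ.IsReductionOf (RingHom.id _) (τ : Field.absoluteGaloisGroup K →* GL (Fin n) (padicAlgClResidueField p)))
    (hunr : ∀ᶠ v : HeightOneSpectrum (𝓞 K) in cofinite, ρ.IsUnramifiedAt v)
    {S : Set (HeightOneSpectrum (𝓞 K))} (hS : S.Finite)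
    (a : HeightOneSpectrum (𝓞 K) → ℕ → padicAlgClIntegers p)
    (hassoc : IsAssociatedFamily n S (fun v j => IsLocalRing.residue (padicAlgClIntegers p) (a v j)) τ)
    (π : CuspidalAutomorphicRepData n K hcpt) (hπalg : π.1.IsLAlgebraic)
    (hπ : ∀ᶠ v : HeightOneSpectrum (𝓞 K) in cofinite, (∃ α : Multiset ℂ, π.1.HasSatakeParamAt v α) ∧
      ∀ α : Multiset ℂ, π.1.HasSatakeParamAt v α →
        arithFrobPolyOfSatake ι v.residueCard 1 α =
          (heckeFrobPoly n (Ideal.absNorm v.asIdeal) (a v)).map (padicAlgClIntegers p).subtype) :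
    IsResiduallyAutomorphicVia hcpt ι ρ π := by
  refine ⟨hπalg, ?_⟩
  have hSc : ∀ᶠ v : HeightOneSpectrum (𝓞 K) in cofinite, v ∉ S := hS.compl_mem_cofinite
  filter_upwards [hunr, hπ, hSc] with v hv hπv hvS
  refine ⟨hv, hπv.1, fun α hα => ?_⟩
  obtain ⟨𝔓, h𝔓⟩ := HeightOneSpectrum.primesAbove_nonempty v
  obtain ⟨φ, hφ⟩ := HeightOneSpectrum.exists_isArithFrobAt_of_mem_primesAbove_holds h𝔓
  obtain ⟨P, hP, hPres⟩ := exists_integral_frobCharpoly ρ hρτ hv h𝔓 hφ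
  refine ⟨P, heckeFrobPoly n (Ideal.absNorm v.asIdeal) (a v), hP, hπv.2 α hα, ?_⟩
  rw [RingHom.id_comp] at hPres
  -- coefficientwise functoriality of `heckeFrobPoly` (= the landed `SteinbergHyperplane.heckeFrobPoly_map`, inlined)
  have hmap : (heckeFrobPoly n (Ideal.absNorm v.asIdeal) (a v)).map (IsLocalRing.residue (padicAlgClIntegers p)) =
      heckeFrobPoly n (Ideal.absNorm v.asIdeal) (fun i => IsLocalRing.residue (padicAlgClIntegers p) (a v i)) := by
    simp [heckeFrobPoly, Polynomial.map_sum]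
  rw [hPres, hmap]
  have h := (hassoc v hvS).2 𝔓 h𝔓 φ hφ
  exact h

/-- **CONGRUENCE TRANSIT.**  If `ρ` and `σ` share a reduction `τ̄` and `σ` is residually automorphic via
`π`, then so is `ρ` (at the places where `ρ` is unramified): `P_ρ ≡ det(X − τ̄ Frob) ≡ P_σ ≡ Q_π`.
[folklore] -/
theorem residuallyAutomorphic_transit (hcpt : isCompact_glFiniteIntegralLevel n K)
    (ι : PadicAlgCl p ≃+* ℂ) (ρ σ : FramedGaloisRep K (PadicAlgCl p) n)
    (τ : Field.absoluteGaloisGroup K →* GL (Fin n) (padicAlgClResidueField p))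
    (hρτ : ρ.IsReductionOf (RingHom.id _) τ) (hστ : σ.IsReductionOf (RingHom.id _) τ)
    (hunr : ∀ᶠ v : HeightOneSpectrum (𝓞 K) in cofinite, ρ.IsUnramifiedAt v)
    (π : CuspidalAutomorphicRepData n K hcpt) (hσ : IsResiduallyAutomorphicVia hcpt ι σ π) :
    IsResiduallyAutomorphicVia hcpt ι ρ π := by
  refine ⟨hσ.1, ?_⟩
  filter_upwards [hunr, hσ.2] with v hv hσv
  obtain ⟨hσunr, hex, hsat⟩ := hσv
  refine ⟨hv, hex, fun α hα => ?_⟩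
  obtain ⟨P, Q, hPσ, hQ, hPQ⟩ := hsat α hα
  obtain ⟨𝔓, h𝔓⟩ := HeightOneSpectrum.primesAbove_nonempty v
  obtain ⟨φ, hφ⟩ := HeightOneSpectrum.exists_isArithFrobAt_of_mem_primesAbove_holds h𝔓
  obtain ⟨P', hP', hP'res⟩ := exists_integral_frobCharpoly ρ hρτ hv h𝔓 hφ
  obtain ⟨S', hS'1, hS'2⟩ :=
    Literature.NumberTheory.GaloisRepresentations.IsReductionOf.hasResidualCharpolys hστ φ
  refine ⟨P', Q, hP', hQ, ?_⟩
  rw [RingHom.id_comp] at hP'res hS'2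
  have hSP : S' = P := by
    apply Polynomial.map_injective (padicAlgClIntegers p).subtype Subtype.val_injective
    rw [hS'1]
    exact hPσ 𝔓 h𝔓 φ hφ
  rw [hP'res, ← hPQ, ← hSP, hS'2]

end Summit.Langlands.Langlands.Theorems.LevelOneDyadic.Transit

/-! ### The two g18 line stubs of TZ, settled (p = 2) -/

namespace Summit.Langlands.Langlands.Theorems.LevelOneDyadic.Transit

open scoped NumberField
open Filter IsDedekindDomain Polynomial
open Literature.NumberTheory.GaloisRepresentations Literature.NumberTheory.Automorphic
open Literature.NumberTheory.Automorphic.BigHeckeGLn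

/-- **`stub_defectZeroLifting` (g18 line `classical-avatar`, stub ALT) PROVED**, signature verbatim: a
classical avatar `σ` congruent to `ρ` that is residually automorphic makes `ρ` residually automorphic —
by `residuallyAutomorphic_transit` (none of the box / defect hypotheses is used). [folklore] -/
theorem defectZeroLifting : ∀ (K : Type) [Field K] [NumberField K] (n : ℕ) (hcpt : Literature.NumberTheory.Automorphic.isCompact_glFiniteIntegralLevel n K), 0 < n → ∀ (ι : PadicAlgCl 2 ≃+* ℂ) (ρ : Literature.NumberTheory.GaloisRepresentations.FramedGaloisRep K (PadicAlgCl 2) n), ρ.toGaloisRep.IsIrreducible → (∀ τ : Field.absoluteGaloisGroup K →* GL (Fin n) (Literature.NumberTheory.GaloisRepresentations.padicAlgClResidueField 2), ρ.IsResidualRepOf (RingHom.id (Literature.NumberTheory.GaloisRepresentations.padicAlgClResidueField 2)) τ → ¬ IsSolvable τ.range) → ¬ (∃ (σ : Literature.NumberTheory.GaloisRepresentations.FramedGaloisRep K (PadicAlgCl 2) n) (τ : Field.absoluteGaloisGroup K →* GL (Fin n) (Literature.NumberTheory.GaloisRepresentations.padicAlgClResidueField 2)), (Set.range (fun g : Field.absoluteGaloisGroup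 K => σ g)).Finite ∧ σ.toGaloisRep.IsIrreducible ∧ ρ.IsResidualRepOf (RingHom.id (Literature.NumberTheory.GaloisRepresentations.padicAlgClResidueField 2)) τ ∧ σ.IsResidualRepOf (RingHom.id (Literature.NumberTheory.GaloisRepresentations.padicAlgClResidueField 2)) τ) → ((∀ᶠ v : IsDedekindDomain.HeightOneSpectrum (NumberField.RingOfIntegers K) in cofinite, ρ.IsUnramifiedAt v) ∧ ∀ (v : IsDedekindDomain.HeightOneSpectrum (NumberField.RingOfIntegers K)) (hv : ((2 : ℕ) : NumberField.RingOfIntegers K) ∈ v.asIdeal), (Literature.NumberTheory.PAdicHodge.fontainePstAdicCompletion v 2 hv).IsDeRhamFramed (ρ.toLocal v)) → (∀ (v : IsDedekindDomain.HeightOneSpectrum (NumberField.RingOfIntegers K)) (hv : ((2 : ℕ) : NumberField.RingOfIntegers K) ∈ v.asIdeal), ∀ e : v.adicCompletion K →+* PadicAlgCl 2, Continuous e → (ρ.labelledHodgeTateWeightsAt v (Literature.NumberTheory.PAdicHodge.fontainePstAdicCompletion v 2 hv).algebra (Literature.NumberTheory.PAdicHodge.fontainePstAdicCompletion v 2 hv).𝔅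 e).Nodup) → (∀ v : IsDedekindDomain.HeightOneSpectrum (NumberField.RingOfIntegers K), ((2 : ℕ) : NumberField.RingOfIntegers K) ∉ v.asIdeal → ρ.IsUnramifiedAt v) → (n = 2 ∧ NumberField.IsTotallyReal K) → (∃ (σ : Literature.NumberTheory.GaloisRepresentations.FramedGaloisRep K (PadicAlgCl 2) n) (τ : Field.absoluteGaloisGroup K →* GL (Fin n) (Literature.NumberTheory.GaloisRepresentations.padicAlgClResidueField 2)), ρ.IsReductionOf (RingHom.id (Literature.NumberTheory.GaloisRepresentations.padicAlgClResidueField 2)) τ ∧ σ.IsReductionOf (RingHom.id (Literature.NumberTheory.GaloisRepresentations.padicAlgClResidueField 2)) τ ∧ (∃ π : Literature.NumberTheory.Automorphic.CuspidalAutomorphicRepData n K hcpt, π.1.IsLAlgebraic ∧ ∀ᶠ v : IsDedekindDomain.HeightOneSpectrum (NumberField.RingOfIntegers K) in cofinite, σ.IsUnramifiedAt v ∧ (∃ α : Multiset ℂ, π.1.HasSatakeParamAt v α) ∧ ∀ α : Multiset ℂ, π.1.HasSatakeParamAt v α → ∃ P Q : Polynomial (Valued.v : Valuation (PadicAlgCl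 2) NNReal).valuationSubring, σ.HasFrobCharpolyAt v (P.map (Valued.v : Valuation (PadicAlgCl 2) NNReal).valuationSubring.subtype) ∧ Literature.NumberTheory.Automorphic.arithFrobPolyOfSatake ι v.residueCard 1 α = Q.map (Valued.v : Valuation (PadicAlgCl 2) NNReal).valuationSubring.subtype ∧ P.map (IsLocalRing.residue (Valued.v : Valuation (PadicAlgCl 2) NNReal).valuationSubring) = Q.map (IsLocalRing.residue (Valued.v : Valuation (PadicAlgCl 2) NNReal).valuationSubring))) → ∃ π : Literature.NumberTheory.Automorphic.CuspidalAutomorphicRepData n K hcpt, π.1.IsLAlgebraic ∧ ∀ᶠ v : IsDedekindDomain.HeightOneSpectrum (NumberField.RingOfIntegers K) in cofinite, ρ.IsUnramifiedAt v ∧ (∃ α : Multiset ℂ, π.1.HasSatakeParamAt v α) ∧ ∀ α : Multiset ℂ, π.1.HasSatakeParamAt v α → ∃ P Q : Polynomial (Valued.v : Valuation (PadicAlgCl 2) NNReal).valuationSubring, ρ.HasFrobCharpolyAt v (P.map (Valued.v : Valuation (PadicAlgCl 2) NNReal).valuationSubring.subtype) ∧ Literature.NumberTheory.Automorphic.arithFrobPolyOfSatake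 ι v.residueCard 1 α = Q.map (Valued.v : Valuation (PadicAlgCl 2) NNReal).valuationSubring.subtype ∧ P.map (IsLocalRing.residue (Valued.v : Valuation (PadicAlgCl 2) NNReal).valuationSubring) = Q.map (IsLocalRing.residue (Valued.v : Valuation (PadicAlgCl 2) NNReal).valuationSubring) := by
  intro K _ _ n hcpt hn ι ρ hirr hins hnl hgeo hreg hlvl hd hcav
  obtain ⟨σ, τ, hρτ, hστ, π, hπ⟩ := hcav
  exact ⟨π, residuallyAutomorphic_transit hcpt ι ρ σ τ hρτ hστ hgeo.1 π hπ⟩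

/-- **`stub_defectZeroClassicalAvatar` (g18 line `classical-avatar`, stub CAV) follows from TZ itself**
with `σ := ρ`: the g18 line was a costume split (CAV ⟺ TZ, ALT = transit). [folklore] -/
theorem classicalAvatar_of_defectZero
    (hZ : Summit.Langlands.Langlands.Theses.FiniteLevelTorsionSplit.DefectZeroTorsionAutomorphy) :
    ∀ (K : Type) [Field K] [NumberField K] (n : ℕ) (hcpt : Literature.NumberTheory.Automorphic.isCompact_glFiniteIntegralLevel n K), 0 < n → ∀ (ι : PadicAlgCl 2 ≃+* ℂ) (ρ : Literature.NumberTheory.GaloisRepresentations.FramedGaloisRep K (PadicAlgCl 2) n), ρ.toGaloisRep.IsIrreducible → (∀ τ : Field.absoluteGaloisGroup K →* GL (Fin n) (Literature.NumberTheory.GaloisRepresentations.padicAlgClResidueField 2), ρ.IsResidualRepOf (RingHom.id (Literature.NumberTheory.GaloisRepresentations.padicAlgClResidueField 2)) τ → ¬ IsSolvable τ.range) → ¬ (∃ (σ : Literature.NumberTheory.GaloisRepresentations.FramedGaloisRep K (PadicAlgCl 2) n) (τ : Field.absoluteGaloisGroup K →* GL (Fin n) (Literature.NumberTheory.GaloisRepresentations.padicAlgClResidueField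 2)), (Set.range (fun g : Field.absoluteGaloisGroup K => σ g)).Finite ∧ σ.toGaloisRep.IsIrreducible ∧ ρ.IsResidualRepOf (RingHom.id (Literature.NumberTheory.GaloisRepresentations.padicAlgClResidueField 2)) τ ∧ σ.IsResidualRepOf (RingHom.id (Literature.NumberTheory.GaloisRepresentations.padicAlgClResidueField 2)) τ) → ((∀ᶠ v : IsDedekindDomain.HeightOneSpectrum (NumberField.RingOfIntegers K) in cofinite, ρ.IsUnramifiedAt v) ∧ ∀ (v : IsDedekindDomain.HeightOneSpectrum (NumberField.RingOfIntegers K)) (hv : ((2 : ℕ) : NumberField.RingOfIntegers K) ∈ v.asIdeal), (Literature.NumberTheory.PAdicHodge.fontainePstAdicCompletion v 2 hv).IsDeRhamFramed (ρ.toLocal v)) → (∀ (v : IsDedekindDomain.HeightOneSpectrum (NumberField.RingOfIntegers K)) (hv : ((2 : ℕ) : NumberField.RingOfIntegers K) ∈ v.asIdeal), ∀ e : v.adicCompletion K →+* PadicAlgCl 2, Continuous e → (ρ.labelledHodgeTateWeightsAt v (Literature.NumberTheory.PAdicHodge.fontainePstAdicCompletion v 2 hv).algebra (Literature.NumberTheory.PAdicHodge.fontainePstAdicCompletion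 v 2 hv).𝔅 e).Nodup) → (∀ v : IsDedekindDomain.HeightOneSpectrum (NumberField.RingOfIntegers K), ((2 : ℕ) : NumberField.RingOfIntegers K) ∉ v.asIdeal → ρ.IsUnramifiedAt v) → (n = 2 ∧ NumberField.IsTotallyReal K) → (letI : TopologicalSpace (Literature.NumberTheory.GaloisRepresentations.padicAlgClResidueField 2) := ⊥; ∃ (idx : ℕ × ℕ × ℕ) (τ : Literature.NumberTheory.GaloisRepresentations.FramedGaloisRep K (Literature.NumberTheory.GaloisRepresentations.padicAlgClResidueField 2) n), ρ.IsReductionOf (RingHom.id (Literature.NumberTheory.GaloisRepresentations.padicAlgClResidueField 2)) (τ : Field.absoluteGaloisGroup K →* GL (Fin n) (Literature.NumberTheory.GaloisRepresentations.padicAlgClResidueField 2)) ∧ ∃ ψ : (Literature.NumberTheory.Automorphic.BigHeckeGLn.TameLevel.full n K 2).levelHeckeSubring idx →+* Literature.NumberTheory.GaloisRepresentations.padicAlgClResidueField 2, Literature.NumberTheory.Automorphic.BigHeckeGLn.IsAssociatedFamily n (Literature.NumberTheory.Automorphic.BigHeckeGLn.TameLevel.full n K 2).bad (fun v j => ψ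 ((Literature.NumberTheory.Automorphic.BigHeckeGLn.TameLevel.full n K 2).levelHeckeT idx v j)) τ) → (∃ (σ : Literature.NumberTheory.GaloisRepresentations.FramedGaloisRep K (PadicAlgCl 2) n) (τ : Field.absoluteGaloisGroup K →* GL (Fin n) (Literature.NumberTheory.GaloisRepresentations.padicAlgClResidueField 2)), ρ.IsReductionOf (RingHom.id (Literature.NumberTheory.GaloisRepresentations.padicAlgClResidueField 2)) τ ∧ σ.IsReductionOf (RingHom.id (Literature.NumberTheory.GaloisRepresentations.padicAlgClResidueField 2)) τ ∧ (∃ π : Literature.NumberTheory.Automorphic.CuspidalAutomorphicRepData n K hcpt, π.1.IsLAlgebraic ∧ ∀ᶠ v : IsDedekindDomain.HeightOneSpectrum (NumberField.RingOfIntegers K) in cofinite, σ.IsUnramifiedAt v ∧ (∃ α : Multiset ℂ, π.1.HasSatakeParamAt v α) ∧ ∀ α : Multiset ℂ, π.1.HasSatakeParamAt v α → ∃ P Q : Polynomial (Valued.v : Valuation (PadicAlgCl 2) NNReal).valuationSubring, σ.HasFrobCharpolyAt v (P.map (Valued.v : Valuation (PadicAlgCl 2) NNReal).valuationSubring.subtype)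 ∧ Literature.NumberTheory.Automorphic.arithFrobPolyOfSatake ι v.residueCard 1 α = Q.map (Valued.v : Valuation (PadicAlgCl 2) NNReal).valuationSubring.subtype ∧ P.map (IsLocalRing.residue (Valued.v : Valuation (PadicAlgCl 2) NNReal).valuationSubring) = Q.map (IsLocalRing.residue (Valued.v : Valuation (PadicAlgCl 2) NNReal).valuationSubring))) := by
  intro K _ _ n hcpt hn ι ρ hirr hins hnl hgeo hreg hlvl hd hav
  have hT := hZ K n hcpt hn ι ρ hirr hins hnl hgeo hreg hlvl hd hav
  obtain ⟨idx, τ, hρτ, ψ, hψ⟩ := hav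
  exact ⟨ρ, (τ : Field.absoluteGaloisGroup K →* GL (Fin n) (Literature.NumberTheory.GaloisRepresentations.padicAlgClResidueField 2)), hρτ, hρτ, hT⟩

/-- Conversely TZ from the two stubs (the g18 composition, for the record). [folklore] -/
theorem defectZero_of_classicalAvatar
    (hC : ∀ (K : Type) [Field K] [NumberField K] (n : ℕ) (hcpt : Literature.NumberTheory.Automorphic.isCompact_glFiniteIntegralLevel n K), 0 < n → ∀ (ι : PadicAlgCl 2 ≃+* ℂ) (ρ : Literature.NumberTheory.GaloisRepresentations.FramedGaloisRep K (PadicAlgCl 2) n), ρ.toGaloisRep.IsIrreducible → (∀ τ : Field.absoluteGaloisGroup K →* GL (Fin n) (Literature.NumberTheory.GaloisRepresentations.padicAlgClResidueField 2), ρ.IsResidualRepOf (RingHom.id (Literature.NumberTheory.GaloisRepresentations.padicAlgClResidueField 2)) τ → ¬ IsSolvable τ.range) → ¬ (∃ (σ : Literature.NumberTheory.GaloisRepresentations.FramedGaloisRep K (PadicAlgCl 2) n) (τ : Field.absoluteGaloisGroup K →* GL (Fin n) (Literature.NumberTheory.GaloisRepresentations.padicAlgClResidueField 2)), (Set.range (fun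 g : Field.absoluteGaloisGroup K => σ g)).Finite ∧ σ.toGaloisRep.IsIrreducible ∧ ρ.IsResidualRepOf (RingHom.id (Literature.NumberTheory.GaloisRepresentations.padicAlgClResidueField 2)) τ ∧ σ.IsResidualRepOf (RingHom.id (Literature.NumberTheory.GaloisRepresentations.padicAlgClResidueField 2)) τ) → ((∀ᶠ v : IsDedekindDomain.HeightOneSpectrum (NumberField.RingOfIntegers K) in cofinite, ρ.IsUnramifiedAt v) ∧ ∀ (v : IsDedekindDomain.HeightOneSpectrum (NumberField.RingOfIntegers K)) (hv : ((2 : ℕ) : NumberField.RingOfIntegers K) ∈ v.asIdeal), (Literature.NumberTheory.PAdicHodge.fontainePstAdicCompletion v 2 hv).IsDeRhamFramed (ρ.toLocal v)) → (∀ (v : IsDedekindDomain.HeightOneSpectrum (NumberField.RingOfIntegers K)) (hv : ((2 : ℕ) : NumberField.RingOfIntegers K) ∈ v.asIdeal), ∀ e : v.adicCompletion K →+* PadicAlgCl 2, Continuous e → (ρ.labelledHodgeTateWeightsAt v (Literature.NumberTheory.PAdicHodge.fontainePstAdicCompletion v 2 hv).algebra (Literature.NumberTheory.PAdicHodge.fontainePstAdicCompletion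 v 2 hv).𝔅 e).Nodup) → (∀ v : IsDedekindDomain.HeightOneSpectrum (NumberField.RingOfIntegers K), ((2 : ℕ) : NumberField.RingOfIntegers K) ∉ v.asIdeal → ρ.IsUnramifiedAt v) → (n = 2 ∧ NumberField.IsTotallyReal K) → (letI : TopologicalSpace (Literature.NumberTheory.GaloisRepresentations.padicAlgClResidueField 2) := ⊥; ∃ (idx : ℕ × ℕ × ℕ) (τ : Literature.NumberTheory.GaloisRepresentations.FramedGaloisRep K (Literature.NumberTheory.GaloisRepresentations.padicAlgClResidueField 2) n), ρ.IsReductionOf (RingHom.id (Literature.NumberTheory.GaloisRepresentations.padicAlgClResidueField 2)) (τ : Field.absoluteGaloisGroup K →* GL (Fin n) (Literature.NumberTheory.GaloisRepresentations.padicAlgClResidueField 2)) ∧ ∃ ψ : (Literature.NumberTheory.Automorphic.BigHeckeGLn.TameLevel.full n K 2).levelHeckeSubring idx →+* Literature.NumberTheory.GaloisRepresentations.padicAlgClResidueField 2, Literature.NumberTheory.Automorphic.BigHeckeGLn.IsAssociatedFamily n (Literature.NumberTheory.Automorphic.BigHeckeGLn.TameLevel.full n K 2).bad (fun v j => ψ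 ((Literature.NumberTheory.Automorphic.BigHeckeGLn.TameLevel.full n K 2).levelHeckeT idx v j)) τ) → (∃ (σ : Literature.NumberTheory.GaloisRepresentations.FramedGaloisRep K (PadicAlgCl 2) n) (τ : Field.absoluteGaloisGroup K →* GL (Fin n) (Literature.NumberTheory.GaloisRepresentations.padicAlgClResidueField 2)), ρ.IsReductionOf (RingHom.id (Literature.NumberTheory.GaloisRepresentations.padicAlgClResidueField 2)) τ ∧ σ.IsReductionOf (RingHom.id (Literature.NumberTheory.GaloisRepresentations.padicAlgClResidueField 2)) τ ∧ (∃ π : Literature.NumberTheory.Automorphic.CuspidalAutomorphicRepData n K hcpt, π.1.IsLAlgebraic ∧ ∀ᶠ v : IsDedekindDomain.HeightOneSpectrum (NumberField.RingOfIntegers K) in cofinite, σ.IsUnramifiedAt v ∧ (∃ α : Multiset ℂ, π.1.HasSatakeParamAt v α) ∧ ∀ α : Multiset ℂ, π.1.HasSatakeParamAt v α → ∃ P Q : Polynomial (Valued.v : Valuation (PadicAlgCl 2) NNReal).valuationSubring, σ.HasFrobCharpolyAt v (P.map (Valued.v : Valuation (PadicAlgCl 2) NNReal).valuationSubring.subtype)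 ∧ Literature.NumberTheory.Automorphic.arithFrobPolyOfSatake ι v.residueCard 1 α = Q.map (Valued.v : Valuation (PadicAlgCl 2) NNReal).valuationSubring.subtype ∧ P.map (IsLocalRing.residue (Valued.v : Valuation (PadicAlgCl 2) NNReal).valuationSubring) = Q.map (IsLocalRing.residue (Valued.v : Valuation (PadicAlgCl 2) NNReal).valuationSubring)))) :
    Summit.Langlands.Langlands.Theses.FiniteLevelTorsionSplit.DefectZeroTorsionAutomorphy := by
  intro K _ _ n hcpt hn ι ρ hirr hins hnl hgeo hreg hlvl hd hav
  exact defectZeroLifting K n hcpt hn ι ρ hirr hins hnl hgeo hreg hlvl hd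
    (hC K n hcpt hn ι ρ hirr hins hnl hgeo hreg hlvl hd hav)

end Summit.Langlands.Langlands.Theorems.LevelOneDyadic.Transit
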